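import Mathlib
import HarnessLib

/-!
# Carleman's convexity method for tracts of an entire function, I: the smoothed log-modulus

Auxiliary calculus for the "de Branges lemma" used in the ordering theorem for chains of de Branges
spaces (L. de Branges 1968, Thm. 35; R. Romanov, *Canonical systems and de Branges spaces*,
arXiv:1408.6022, Appendix III, Proposition 26 and Lemma 27 (Carleman)). Following Romanov's proof of
Lemma 27 we work with a **smooth** non-negative subharmonic function with the same positivity set as
`log⁺ (|Ξ|/e)`: `U = H(log |Ξ|)` where `H` is a smooth convex ramp vanishing on `(-∞, 1]`
(Romanov mollifies `log⁺|ξ|` instead; the smooth sramp avoids mollification). In logarithmic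
coordinates `w = s + iθ` (so that circles `|z| = e^s` become segments `θ ∈ [0, 2π]`) we record the
partial derivatives of `U` along `s` and `θ` in closed form and the subharmonicity
`U_ss + U_θθ = H''(log|Ξ|) |Ξ'/Ξ|² ≥ 0`.

Everything here is PROVED; no named facts.

## References

* R. Romanov, arXiv:1408.6022, Appendix III (Lemma 27 and its proof).
* L. de Branges, *Hilbert spaces of entire functions* (1968), Theorem 35.
-/

open Real Set Filter Topology

noncomputable section

namespace Literature.Analysis.Complex

namespace CarlemanTract

/-! ### The smooth convex ramp `H` -/

/-- The smooth convex ramp `H(x) = (x - 1) e^{-1/(x-1)}` for `x > 1`, `H(x) = 0` for `x ≤ 1`.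
[cite: Romanov2014, App. III proof of Lemma 27 (smoothing of `log⁺`)] -/
def sramp (x : ℝ) : ℝ := (x - 1) * expNegInvGlue (x - 1)

/-- Auxiliary step of the Carleman tract calculus (see the section header). [folklore] -/
theorem sramp_of_le_one {x : ℝ} (hx : x ≤ 1) : sramp x = 0 := by
  simp [sramp, expNegInvGlue.zero_of_nonpos (sub_nonpos.2 hx)]

/-- Auxiliary step of the Carleman tract calculus (see the section header). [folklore] -/
theorem sramp_of_one_lt {x : ℝ} (hx : 1 < x) : sramp x = (x - 1) * exp (-(x - 1)⁻¹) := by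
  have : ¬ (x - 1 ≤ 0) := by linarith
  simp [sramp, expNegInvGlue, this]

/-- Auxiliary step of the Carleman tract calculus (see the section header). [folklore] -/
theorem sramp_nonneg (x : ℝ) : 0 ≤ sramp x := by
  rcases le_or_gt x 1 with hx | hx
  · rw [sramp_of_le_one hx]
  · rw [sramp_of_one_lt hx]; exact mul_nonneg (by linarith) (exp_pos _).le

/-- `H(x) ≤ max (x - 1) 0 ≤ |x|`. [folklore] -/
theorem sramp_le (x : ℝ) : sramp x ≤ max (x - 1) 0 := by
  rcases le_or_gt x 1 with hx | hx
  · rw [sramp_of_le_one hx]; exact le_max_right _ _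
  · rw [sramp_of_one_lt hx]
    refine le_trans ?_ (le_max_left _ _)
    have h1 : exp (-(x - 1)⁻¹) ≤ 1 := by
      rw [exp_le_one_iff, neg_nonpos]; exact inv_nonneg.2 (by linarith)
    nlinarith

/-- Auxiliary step of the Carleman tract calculus (see the section header). [folklore] -/
theorem contDiff_sramp {n : ℕ∞} : ContDiff ℝ n sramp := by
  unfold sramp
  exact (contDiff_id.sub contDiff_const).mul (expNegInvGlue.contDiff.comp (contDiff_id.sub contDiff_const))

/-- Auxiliary step of the Carleman tract calculus (see the section header). [folklore] -/
theorem differentiable_sramp : Differentiable ℝ sramp :=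
  (contDiff_sramp (n := 1)).differentiable (by simp)

/-- Auxiliary step of the Carleman tract calculus (see the section header). [folklore] -/
theorem continuous_sramp : Continuous sramp := differentiable_sramp.continuous

/-- `H` vanishes identically near every point of `(-∞, 1)`. [folklore] -/
theorem sramp_eventuallyEq_zero {x : ℝ} (hx : x < 1) : sramp =ᶠ[𝓝 x] fun _ => 0 := by
  filter_upwards [Iio_mem_nhds hx] with y hy using sramp_of_le_one (le_of_lt hy)

/-- On `(1, ∞)`: `H'(x) = e^{-1/(x-1)} (1 + (x-1)⁻¹)`. [folklore] -/
theorem hasDerivAt_ramp_of_one_lt {x : ℝ} (hx : 1 < x) :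
    HasDerivAt sramp (exp (-(x - 1)⁻¹) * (1 + (x - 1)⁻¹)) x := by
  have hx0 : x - 1 ≠ 0 := by linarith
  have h1 : HasDerivAt (fun y : ℝ => y - 1) 1 x := (hasDerivAt_id x).sub_const 1
  have h2 : HasDerivAt (fun y : ℝ => -(y - 1)⁻¹) ((x - 1) ^ 2)⁻¹ x := by
    have h := (h1.inv hx0).neg
    have heq : -(-(1 : ℝ) / (x - 1) ^ 2) = ((x - 1) ^ 2)⁻¹ := by rw [neg_div, neg_neg, one_div]
    rw [heq] at h
    exact h
  have h3 : HasDerivAt (fun y : ℝ => exp (-(y - 1)⁻¹)) (exp (-(x - 1)⁻¹) * ((x - 1) ^ 2)⁻¹) x :=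
    h2.exp
  have h4 := h1.mul h3
  have heq : sramp =ᶠ[𝓝 x] fun y => (y - 1) * exp (-(y - 1)⁻¹) := by
    filter_upwards [Ioi_mem_nhds hx] with y hy using sramp_of_one_lt hy
  refine (h4.congr_of_eventuallyEq heq).congr_deriv ?_
  have h5 : (x - 1) * ((x - 1) ^ 2)⁻¹ = (x - 1)⁻¹ := by field_simp
  calc 1 * exp (-(x - 1)⁻¹) + (x - 1) * (exp (-(x - 1)⁻¹) * ((x - 1) ^ 2)⁻¹)
        = exp (-(x - 1)⁻¹) * (1 + (x - 1) * ((x - 1) ^ 2)⁻¹) := by ring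
    _ = exp (-(x - 1)⁻¹) * (1 + (x - 1)⁻¹) := by rw [h5]

/-- Auxiliary step of the Carleman tract calculus (see the section header). [folklore] -/
theorem deriv_ramp_of_one_lt {x : ℝ} (hx : 1 < x) :
    deriv sramp x = exp (-(x - 1)⁻¹) * (1 + (x - 1)⁻¹) :=
  (hasDerivAt_ramp_of_one_lt hx).deriv

/-- Auxiliary step of the Carleman tract calculus (see the section header). [folklore] -/
theorem deriv_ramp_of_lt_one {x : ℝ} (hx : x < 1) : deriv sramp x = 0 := by
  rw [Filter.EventuallyEq.deriv_eq (sramp_eventuallyEq_zero hx)]; simp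

/-- Auxiliary step of the Carleman tract calculus (see the section header). [folklore] -/
theorem deriv_ramp_one : deriv sramp 1 = 0 := by
  apply IsLocalMin.deriv_eq_zero
  filter_upwards [] with y
  rw [sramp_of_le_one le_rfl]; exact sramp_nonneg y

/-- Auxiliary step of the Carleman tract calculus (see the section header). [folklore] -/
theorem deriv_ramp_of_le_one {x : ℝ} (hx : x ≤ 1) : deriv sramp x = 0 := by
  rcases lt_or_eq_of_le hx with h | h
  · exact deriv_ramp_of_lt_one h
  · rw [h]; exact deriv_ramp_one

/-- Auxiliary step of the Carleman tract calculus (see the section header). [folklore] -/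
theorem deriv_ramp_nonneg (x : ℝ) : 0 ≤ deriv sramp x := by
  rcases le_or_gt x 1 with hx | hx
  · rw [deriv_ramp_of_le_one hx]
  · rw [deriv_ramp_of_one_lt hx]
    have : 0 < (x - 1)⁻¹ := inv_pos.2 (by linarith)
    positivity

/-- Auxiliary step of the Carleman tract calculus (see the section header). [folklore] -/
theorem contDiff_deriv_sramp {n : ℕ∞} : ContDiff ℝ n (deriv sramp) := by
  have := (contDiff_sramp (n := n + 1))
  exact (contDiff_succ_iff_deriv.1 (contDiff_sramp (n := n + 1))).2.2

/-- Auxiliary step of the Carleman tract calculus (see the section header). [folklore] -/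
theorem differentiable_deriv_sramp : Differentiable ℝ (deriv sramp) :=
  (contDiff_deriv_sramp (n := 1)).differentiable (by simp)

/-- Auxiliary step of the Carleman tract calculus (see the section header). [folklore] -/
theorem continuous_deriv_sramp : Continuous (deriv sramp) := differentiable_deriv_sramp.continuous

/-- Auxiliary step of the Carleman tract calculus (see the section header). [folklore] -/
theorem hasDerivAt_sramp (x : ℝ) : HasDerivAt sramp (deriv sramp x) x :=
  (differentiable_sramp x).hasDerivAt

/-- Auxiliary step of the Carleman tract calculus (see the section header). [folklore] -/
theorem hasDerivAt_deriv_sramp (x : ℝ) : HasDerivAt (deriv sramp) (deriv (deriv sramp) x) x :=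
  (differentiable_deriv_sramp x).hasDerivAt

/-- On `(1, ∞)`: `H''(x) = e^{-1/(x-1)} (x-1)⁻³ > 0`. [folklore] -/
theorem hasDerivAt_deriv_ramp_of_one_lt {x : ℝ} (hx : 1 < x) :
    HasDerivAt (deriv sramp) (exp (-(x - 1)⁻¹) * ((x - 1) ^ 3)⁻¹) x := by
  have hx0 : x - 1 ≠ 0 := by linarith
  have h1 : HasDerivAt (fun y : ℝ => y - 1) 1 x := (hasDerivAt_id x).sub_const 1
  have h2 : HasDerivAt (fun y : ℝ => -(y - 1)⁻¹) ((x - 1) ^ 2)⁻¹ x := by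
    have h := (h1.inv hx0).neg
    have heq : -(-(1 : ℝ) / (x - 1) ^ 2) = ((x - 1) ^ 2)⁻¹ := by rw [neg_div, neg_neg, one_div]
    rw [heq] at h
    exact h
  have h3 : HasDerivAt (fun y : ℝ => exp (-(y - 1)⁻¹)) (exp (-(x - 1)⁻¹) * ((x - 1) ^ 2)⁻¹) x :=
    h2.exp
  have h5 : HasDerivAt (fun y : ℝ => 1 + (y - 1)⁻¹) (-((x - 1) ^ 2)⁻¹) x := by
    have h := (h1.inv hx0).const_add 1
    have heq : (-(1 : ℝ) / (x - 1) ^ 2) = -((x - 1) ^ 2)⁻¹ := by rw [neg_div, one_div]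
    rw [heq] at h
    exact h
  have h4 := h3.mul h5
  have heq : deriv sramp =ᶠ[𝓝 x] fun y => exp (-(y - 1)⁻¹) * (1 + (y - 1)⁻¹) := by
    filter_upwards [Ioi_mem_nhds hx] with y hy using deriv_ramp_of_one_lt hy
  refine (h4.congr_of_eventuallyEq heq).congr_deriv ?_
  have h6 : ((x - 1) ^ 2)⁻¹ * (1 + (x - 1)⁻¹) - ((x - 1) ^ 2)⁻¹ = ((x - 1) ^ 3)⁻¹ := by
    field_simp; ring
  calc exp (-(x - 1)⁻¹) * ((x - 1) ^ 2)⁻¹ * (1 + (x - 1)⁻¹) + exp (-(x - 1)⁻¹) * -((x - 1) ^ 2)⁻¹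
        = exp (-(x - 1)⁻¹) * (((x - 1) ^ 2)⁻¹ * (1 + (x - 1)⁻¹) - ((x - 1) ^ 2)⁻¹) := by ring
    _ = exp (-(x - 1)⁻¹) * ((x - 1) ^ 3)⁻¹ := by rw [h6]

/-- Auxiliary step of the Carleman tract calculus (see the section header). [folklore] -/
theorem deriv2_ramp_of_one_lt {x : ℝ} (hx : 1 < x) :
    deriv (deriv sramp) x = exp (-(x - 1)⁻¹) * ((x - 1) ^ 3)⁻¹ :=
  (hasDerivAt_deriv_ramp_of_one_lt hx).deriv

/-- Auxiliary step of the Carleman tract calculus (see the section header). [folklore] -/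
theorem deriv2_ramp_pos {x : ℝ} (hx : 1 < x) : 0 < deriv (deriv sramp) x := by
  rw [deriv2_ramp_of_one_lt hx]
  have : 0 < x - 1 := by linarith
  positivity

/-- Auxiliary step of the Carleman tract calculus (see the section header). [folklore] -/
theorem deriv_ramp_eventuallyEq_zero {x : ℝ} (hx : x < 1) : deriv sramp =ᶠ[𝓝 x] fun _ => 0 := by
  filter_upwards [Iio_mem_nhds hx] with y hy using deriv_ramp_of_le_one (le_of_lt hy)

/-- Auxiliary step of the Carleman tract calculus (see the section header). [folklore] -/
theorem deriv2_ramp_of_lt_one {x : ℝ} (hx : x < 1) : deriv (deriv sramp) x = 0 := by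
  rw [Filter.EventuallyEq.deriv_eq (deriv_ramp_eventuallyEq_zero hx)]; simp

/-- Auxiliary step of the Carleman tract calculus (see the section header). [folklore] -/
theorem deriv2_ramp_one : deriv (deriv sramp) 1 = 0 := by
  apply IsLocalMin.deriv_eq_zero
  filter_upwards [] with y
  rw [deriv_ramp_one]; exact deriv_ramp_nonneg y

/-- Auxiliary step of the Carleman tract calculus (see the section header). [folklore] -/
theorem deriv2_ramp_of_le_one {x : ℝ} (hx : x ≤ 1) : deriv (deriv sramp) x = 0 := by
  rcases lt_or_eq_of_le hx with h | h
  · exact deriv2_ramp_of_lt_one h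
  · rw [h]; exact deriv2_ramp_one

/-- Auxiliary step of the Carleman tract calculus (see the section header). [folklore] -/
theorem deriv2_ramp_nonneg (x : ℝ) : 0 ≤ deriv (deriv sramp) x := by
  rcases le_or_gt x 1 with hx | hx
  · rw [deriv2_ramp_of_le_one hx]
  · exact (deriv2_ramp_pos hx).le

/-- Auxiliary step of the Carleman tract calculus (see the section header). [folklore] -/
theorem continuous_deriv2_sramp : Continuous (deriv (deriv sramp)) :=
  (contDiff_deriv_sramp (n := 1)).continuous_deriv le_rfl


/-! ### Derivatives along horizontal and vertical lines -/

section Lines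

open _root_.Complex

/-- Restriction of a complex derivative to a horizontal line. [folklore] -/
theorem hasDerivAt_line_re {f : ℂ → ℂ} {f' : ℂ} {s θ : ℝ}
    (h : HasDerivAt f f' ((s : ℂ) + θ * I)) :
    HasDerivAt (fun t : ℝ => f ((t : ℂ) + θ * I)) f' s :=
  (HasDerivAt.comp_add_const (s : ℂ) (θ * I) h).comp_ofReal

/-- Real part of the restriction of a complex derivative to a horizontal line. [folklore] -/
theorem hasDerivAt_line_re_re {f : ℂ → ℂ} {f' : ℂ} {s θ : ℝ}
    (h : HasDerivAt f f' ((s : ℂ) + θ * I)) :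
    HasDerivAt (fun t : ℝ => (f ((t : ℂ) + θ * I)).re) f'.re s :=
  (HasDerivAt.comp_add_const (s : ℂ) (θ * I) h).real_of_complex

/-- The vertical line `z ↦ f (s + z I)` has complex derivative `f' I`. [folklore] -/
theorem hasDerivAt_line_im_complex {f : ℂ → ℂ} {f' : ℂ} {s θ : ℝ}
    (h : HasDerivAt f f' ((s : ℂ) + θ * I)) :
    HasDerivAt (fun z : ℂ => f ((s : ℂ) + z * I)) (f' * I) (θ : ℂ) := by
  have hin : HasDerivAt (fun z : ℂ => (s : ℂ) + z * I) I (θ : ℂ) := by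
    simpa using ((hasDerivAt_id (θ : ℂ)).mul_const I).const_add (s : ℂ)
  have := h.comp (θ : ℂ) hin
  simpa [Function.comp_def] using this

/-- Restriction of a complex derivative to a vertical line. [folklore] -/
theorem hasDerivAt_line_im {f : ℂ → ℂ} {f' : ℂ} {s θ : ℝ}
    (h : HasDerivAt f f' ((s : ℂ) + θ * I)) :
    HasDerivAt (fun t : ℝ => f ((s : ℂ) + t * I)) (f' * I) θ :=
  (hasDerivAt_line_im_complex h).comp_ofReal

/-- Real part of the restriction of a complex derivative to a vertical line. [folklore] -/
theorem hasDerivAt_line_im_re {f : ℂ → ℂ} {f' : ℂ} {s θ : ℝ}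
    (h : HasDerivAt f f' ((s : ℂ) + θ * I)) :
    HasDerivAt (fun t : ℝ => (f ((s : ℂ) + t * I)).re) (-f'.im) θ := by
  have h2 := (hasDerivAt_line_im_complex h).real_of_complex
  have him : (f' * I).re = -f'.im := by simp
  rw [him] at h2
  exact h2

/-- Imaginary part of the restriction of a complex derivative to a vertical line. [folklore] -/
theorem hasDerivAt_line_im_im {f : ℂ → ℂ} {f' : ℂ} {s θ : ℝ}
    (h : HasDerivAt f f' ((s : ℂ) + θ * I)) :
    HasDerivAt (fun t : ℝ => (f ((s : ℂ) + t * I)).im) f'.re θ := by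
  have h3 := (hasDerivAt_line_im_complex h).const_mul (-I)
  have h4 := h3.real_of_complex
  have e1 : ∀ z : ℂ, (-I * z).re = z.im := by intro z; simp
  have e2 : (-I * (f' * I)).re = f'.re := by simp
  simp only [e1] at h4
  rw [show (f' * I).im = f'.re by simp] at h4
  exact h4

end Lines

/-! ### The smoothed log-modulus `U = H(log |Ξ|)` and its partial derivatives -/

section Tract

open _root_.Complex

variable (Ξ : ℂ → ℂ)

/-- `v = log |Ξ|` (with Mathlib's junk value `log 0 = 0` at the zeros of `Ξ`). [folklore] -/
def logMod (w : ℂ) : ℝ := Real.log ‖Ξ w‖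

/-- The smooth tract function `U = H(log |Ξ|)`; `U ≥ 0`, and `U > 0` exactly where `|Ξ| > e`.
[cite: Romanov2014, App. III proof of Lemma 27] -/
def tract (w : ℂ) : ℝ := sramp (logMod Ξ w)

/-- `U_s = H'(v) Re(Ξ'/Ξ)` (partial derivative along `Re w`). [folklore] -/
def tractS (w : ℂ) : ℝ := deriv sramp (logMod Ξ w) * (logDeriv Ξ w).re

/-- `U_θ = -H'(v) Im(Ξ'/Ξ)` (partial derivative along `Im w`). [folklore] -/
def tractT (w : ℂ) : ℝ := -(deriv sramp (logMod Ξ w) * (logDeriv Ξ w).im)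

/-- `U_ss = H''(v) (Re P)² + H'(v) Re P'`, `P = Ξ'/Ξ`. [folklore] -/
def tractSS (w : ℂ) : ℝ :=
  deriv (deriv sramp) (logMod Ξ w) * (logDeriv Ξ w).re ^ 2 +
    deriv sramp (logMod Ξ w) * (deriv (logDeriv Ξ) w).re

/-- `U_θθ = H''(v) (Im P)² - H'(v) Re P'`, `P = Ξ'/Ξ`. [folklore] -/
def tractTT (w : ℂ) : ℝ :=
  deriv (deriv sramp) (logMod Ξ w) * (logDeriv Ξ w).im ^ 2 -
    deriv sramp (logMod Ξ w) * (deriv (logDeriv Ξ) w).re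

/-- Auxiliary step of the Carleman tract calculus (see the section header). [folklore] -/
theorem tract_nonneg (w : ℂ) : 0 ≤ tract Ξ w := sramp_nonneg _

/-- **Subharmonicity** of `U` in the coordinates `(s, θ)`: `U_ss + U_θθ = H''(v) |Ξ'/Ξ|² ≥ 0`. [folklore] -/
theorem tractSS_add_tractTT (w : ℂ) :
    tractSS Ξ w + tractTT Ξ w = deriv (deriv sramp) (logMod Ξ w) * ‖logDeriv Ξ w‖ ^ 2 := by
  rw [tractSS, tractTT, ← Complex.normSq_eq_norm_sq, Complex.normSq_apply]
  ring

/-- Auxiliary step of the Carleman tract calculus (see the section header). [folklore] -/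
theorem tractSS_add_tractTT_nonneg (w : ℂ) : 0 ≤ tractSS Ξ w + tractTT Ξ w := by
  rw [tractSS_add_tractTT]
  exact mul_nonneg (deriv2_ramp_nonneg _) (by positivity)

variable {Ξ}

/-- Auxiliary step of the Carleman tract calculus (see the section header). [folklore] -/
theorem logMod_lt_one_of_norm_lt {w : ℂ} (hw : ‖Ξ w‖ < Real.exp 1) : logMod Ξ w < 1 := by
  unfold logMod
  rcases eq_or_lt_of_le (norm_nonneg (Ξ w)) with h0 | hpos
  · rw [← h0, Real.log_zero]; exact zero_lt_one
  · rwa [Real.log_lt_iff_lt_exp hpos]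

/-- Auxiliary step of the Carleman tract calculus (see the section header). [folklore] -/
theorem one_lt_logMod_of_lt_norm {w : ℂ} (hw : Real.exp 1 < ‖Ξ w‖) : 1 < logMod Ξ w := by
  unfold logMod
  have hpos : 0 < ‖Ξ w‖ := lt_trans (Real.exp_pos 1) hw
  rwa [Real.lt_log_iff_exp_lt hpos]

/-- `U > 0` exactly where `|Ξ| > e`. [folklore] -/
theorem tract_pos_iff {w : ℂ} : 0 < tract Ξ w ↔ Real.exp 1 < ‖Ξ w‖ := by
  constructor
  · intro h
    by_contra hle
    push Not at hle
    have : logMod Ξ w ≤ 1 := by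
      rcases eq_or_lt_of_le hle with heq | hlt
      · unfold logMod; rw [heq, Real.log_exp]
      · exact (logMod_lt_one_of_norm_lt hlt).le
    rw [tract, sramp_of_le_one this] at h
    exact lt_irrefl _ h
  · intro h
    rw [tract, sramp_of_one_lt (one_lt_logMod_of_lt_norm h)]
    have h1 : 0 < logMod Ξ w - 1 := by linarith [one_lt_logMod_of_lt_norm h]
    positivity

/-- Auxiliary step of the Carleman tract calculus (see the section header). [folklore] -/
theorem tract_eq_zero_iff {w : ℂ} : tract Ξ w = 0 ↔ ‖Ξ w‖ ≤ Real.exp 1 := by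
  have h := tract_pos_iff (Ξ := Ξ) (w := w)
  have h0 := tract_nonneg Ξ w
  constructor
  · intro hz; by_contra hc; push Not at hc
    have := h.2 hc; linarith
  · intro hle
    rcases eq_or_lt_of_le h0 with he | hlt
    · exact he.symm
    · exact absurd (h.1 hlt) (not_lt.2 hle)

/-- Growth: `U ≤ log |Ξ|` wherever `|Ξ| ≥ 1`, hence `U(w) ≤ max (log |Ξ w|) 0` always. [folklore] -/
theorem tract_le (w : ℂ) : tract Ξ w ≤ max (Real.log ‖Ξ w‖) 0 := by
  refine (sramp_le _).trans ?_
  unfold logMod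
  exact max_le_max (by linarith) le_rfl

/-- The set `{|Ξ| < e}` is open; on it `U`, `U_s`, `U_θ`, `U_ss`, `U_θθ` all vanish. [folklore] -/
theorem isOpen_norm_lt (hΞ : Differentiable ℂ Ξ) : IsOpen {w : ℂ | ‖Ξ w‖ < Real.exp 1} :=
  isOpen_lt (continuous_norm.comp hΞ.continuous) continuous_const

/-- Auxiliary step of the Carleman tract calculus (see the section header). [folklore] -/
theorem tract_eq_zero_of_norm_lt {w : ℂ} (hw : ‖Ξ w‖ < Real.exp 1) : tract Ξ w = 0 :=
  sramp_of_le_one (logMod_lt_one_of_norm_lt hw).le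

/-- Auxiliary step of the Carleman tract calculus (see the section header). [folklore] -/
theorem tractS_eq_zero_of_norm_lt {w : ℂ} (hw : ‖Ξ w‖ < Real.exp 1) : tractS Ξ w = 0 := by
  rw [tractS, deriv_ramp_of_le_one (logMod_lt_one_of_norm_lt hw).le, zero_mul]

/-- Auxiliary step of the Carleman tract calculus (see the section header). [folklore] -/
theorem tractT_eq_zero_of_norm_lt {w : ℂ} (hw : ‖Ξ w‖ < Real.exp 1) : tractT Ξ w = 0 := by
  rw [tractT, deriv_ramp_of_le_one (logMod_lt_one_of_norm_lt hw).le, zero_mul, neg_zero]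

/-- Auxiliary step of the Carleman tract calculus (see the section header). [folklore] -/
theorem tractSS_eq_zero_of_norm_lt {w : ℂ} (hw : ‖Ξ w‖ < Real.exp 1) : tractSS Ξ w = 0 := by
  rw [tractSS, deriv_ramp_of_le_one (logMod_lt_one_of_norm_lt hw).le,
    deriv2_ramp_of_le_one (logMod_lt_one_of_norm_lt hw).le]; ring

/-- Auxiliary step of the Carleman tract calculus (see the section header). [folklore] -/
theorem tractTT_eq_zero_of_norm_lt {w : ℂ} (hw : ‖Ξ w‖ < Real.exp 1) : tractTT Ξ w = 0 := by
  rw [tractTT, deriv_ramp_of_le_one (logMod_lt_one_of_norm_lt hw).le,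
    deriv2_ramp_of_le_one (logMod_lt_one_of_norm_lt hw).le]; ring

/-- A local holomorphic logarithm: near a point where `Ξ ≠ 0`, `log |Ξ| = Re L + const` with
`L' = Ξ'/Ξ`. [folklore] -/
theorem exists_ball_log (hΞ : Differentiable ℂ Ξ) {w₀ : ℂ} (h0 : Ξ w₀ ≠ 0) :
    ∃ ε > 0, ∀ w ∈ Metric.ball w₀ ε, Ξ w ≠ 0 ∧
      HasDerivAt (fun w => Complex.log (Ξ w / Ξ w₀)) (logDeriv Ξ w) w ∧
      logMod Ξ w = (Complex.log (Ξ w / Ξ w₀)).re + Real.log ‖Ξ w₀‖ := by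
  have hc : ContinuousAt (fun w => Ξ w / Ξ w₀) w₀ := (hΞ.continuous.continuousAt).div_const _
  have h1 : Ξ w₀ / Ξ w₀ = 1 := div_self h0
  have hev : ∀ᶠ w in 𝓝 w₀, ‖Ξ w / Ξ w₀ - 1‖ < 1 := by
    have := hc.tendsto
    simp only [h1] at this
    have h2 := (this.sub_const 1)
    rw [sub_self] at h2
    have h3 := h2.norm
    rw [norm_zero] at h3
    exact h3.eventually (gt_mem_nhds zero_lt_one)
  obtain ⟨ε, hε, hball⟩ := Metric.eventually_nhds_iff_ball.1 hev
  refine ⟨ε, hε, fun w hw => ?_⟩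
  have hlt := hball w hw
  have hslit : Ξ w / Ξ w₀ ∈ slitPlane := by
    have := mem_slitPlane_of_norm_lt_one hlt
    simpa using this
  have hne : Ξ w / Ξ w₀ ≠ 0 := slitPlane_ne_zero hslit
  have hΞw : Ξ w ≠ 0 := by
    intro h; rw [h, zero_div] at hne; exact hne rfl
  refine ⟨hΞw, ?_, ?_⟩
  · have hd : HasDerivAt (fun w => Ξ w / Ξ w₀) (deriv Ξ w / Ξ w₀) w :=
      (hΞ w).hasDerivAt.div_const _
    have := hd.clog hslit
    refine this.congr_deriv ?_
    rw [logDeriv_apply]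
    field_simp
  · rw [logMod, Complex.log_re, norm_div, Real.log_div (norm_ne_zero_iff.2 hΞw)
      (norm_ne_zero_iff.2 h0)]
    ring

/-- `Ξ'/Ξ` is differentiable where `Ξ ≠ 0`. [folklore] -/
theorem hasDerivAt_logDeriv (hΞ : Differentiable ℂ Ξ) {w : ℂ} (h0 : Ξ w ≠ 0) :
    HasDerivAt (logDeriv Ξ) (deriv (logDeriv Ξ) w) w := by
  have hd : DifferentiableAt ℂ (logDeriv Ξ) w := by
    have h1 : DifferentiableAt ℂ (deriv Ξ) w := ((hΞ.analyticAt w).deriv).differentiableAt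
    exact h1.div (hΞ w) h0
  exact hd.hasDerivAt

/-- `∂U/∂s = U_s`. [folklore] -/
theorem hasDerivAt_tract_re (hΞ : Differentiable ℂ Ξ) (s θ : ℝ) :
    HasDerivAt (fun t : ℝ => tract Ξ ((t : ℂ) + θ * I)) (tractS Ξ ((s : ℂ) + θ * I)) s := by
  set w₀ : ℂ := (s : ℂ) + θ * I with hw₀
  by_cases hlt : ‖Ξ w₀‖ < Real.exp 1
  · -- locally zero
    have hev : ∀ᶠ t : ℝ in 𝓝 s, tract Ξ ((t : ℂ) + θ * I) = 0 := by
      have hc : Continuous fun t : ℝ => ((t : ℂ) + θ * I) := by fun_prop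
      have := (isOpen_norm_lt hΞ).preimage hc
      exact Filter.eventually_of_mem (this.mem_nhds (by simpa [hw₀] using hlt))
        fun t ht => tract_eq_zero_of_norm_lt ht
    rw [tractS_eq_zero_of_norm_lt hlt]
    exact (hasDerivAt_const s (0 : ℝ)).congr_of_eventuallyEq hev
  · have h0 : Ξ w₀ ≠ 0 := by
      intro h; rw [h, norm_zero] at hlt; exact hlt (Real.exp_pos 1)
    obtain ⟨ε, hε, hball⟩ := exists_ball_log hΞ h0
    set L : ℂ → ℂ := fun w => Complex.log (Ξ w / Ξ w₀)
    -- log-modulus along the line is `Re L + c`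
    have hc : Continuous fun t : ℝ => ((t : ℂ) + θ * I) := by fun_prop
    have hev : ∀ᶠ t : ℝ in 𝓝 s, ((t : ℂ) + θ * I) ∈ Metric.ball w₀ ε := by
      have : IsOpen ((fun t : ℝ => ((t : ℂ) + θ * I)) ⁻¹' Metric.ball w₀ ε) :=
        Metric.isOpen_ball.preimage hc
      exact this.mem_nhds (by simp [hw₀, Metric.mem_ball, hε])
    have hlog : HasDerivAt (fun t : ℝ => logMod Ξ ((t : ℂ) + θ * I))
        ((logDeriv Ξ w₀).re) s := by
      have h1 : HasDerivAt (fun t : ℝ => (L ((t : ℂ) + θ * I)).re + Real.log ‖Ξ w₀‖)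
          ((logDeriv Ξ w₀).re) s := by
        have := (hball w₀ (Metric.mem_ball_self hε)).2.1
        exact (hasDerivAt_line_re_re this).add_const _
      refine h1.congr_of_eventuallyEq ?_
      filter_upwards [hev] with t ht using (hball _ ht).2.2
    have h2 := (hasDerivAt_sramp (logMod Ξ w₀)).comp s hlog
    have h3 : HasDerivAt (fun t : ℝ => tract Ξ ((t : ℂ) + θ * I))
        (deriv sramp (logMod Ξ w₀) * (logDeriv Ξ w₀).re) s := by
      simpa only [Function.comp_def, tract] using h2
    exact h3

/-- `∂U/∂θ = U_θ`. [folklore] -/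
theorem hasDerivAt_tract_im (hΞ : Differentiable ℂ Ξ) (s θ : ℝ) :
    HasDerivAt (fun t : ℝ => tract Ξ ((s : ℂ) + t * I)) (tractT Ξ ((s : ℂ) + θ * I)) θ := by
  set w₀ : ℂ := (s : ℂ) + θ * I with hw₀
  by_cases hlt : ‖Ξ w₀‖ < Real.exp 1
  · have hev : ∀ᶠ t : ℝ in 𝓝 θ, tract Ξ ((s : ℂ) + t * I) = 0 := by
      have hc : Continuous fun t : ℝ => ((s : ℂ) + t * I) := by fun_prop
      have := (isOpen_norm_lt hΞ).preimage hc
      exact Filter.eventually_of_mem (this.mem_nhds (by simpa [hw₀] using hlt))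
        fun t ht => tract_eq_zero_of_norm_lt ht
    rw [tractT_eq_zero_of_norm_lt hlt]
    exact (hasDerivAt_const θ (0 : ℝ)).congr_of_eventuallyEq hev
  · have h0 : Ξ w₀ ≠ 0 := by
      intro h; rw [h, norm_zero] at hlt; exact hlt (Real.exp_pos 1)
    obtain ⟨ε, hε, hball⟩ := exists_ball_log hΞ h0
    set L : ℂ → ℂ := fun w => Complex.log (Ξ w / Ξ w₀)
    have hc : Continuous fun t : ℝ => ((s : ℂ) + t * I) := by fun_prop
    have hev : ∀ᶠ t : ℝ in 𝓝 θ, ((s : ℂ) + t * I) ∈ Metric.ball w₀ ε := by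
      have : IsOpen ((fun t : ℝ => ((s : ℂ) + t * I)) ⁻¹' Metric.ball w₀ ε) :=
        Metric.isOpen_ball.preimage hc
      exact this.mem_nhds (by simp [hw₀, Metric.mem_ball, hε])
    have hlog : HasDerivAt (fun t : ℝ => logMod Ξ ((s : ℂ) + t * I))
        (-(logDeriv Ξ w₀).im) θ := by
      have h1 : HasDerivAt (fun t : ℝ => (L ((s : ℂ) + t * I)).re + Real.log ‖Ξ w₀‖)
          (-(logDeriv Ξ w₀).im) θ := by
        have := (hball w₀ (Metric.mem_ball_self hε)).2.1
        exact (hasDerivAt_line_im_re this).add_const _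
      refine h1.congr_of_eventuallyEq ?_
      filter_upwards [hev] with t ht using (hball _ ht).2.2
    have h2 := (hasDerivAt_sramp (logMod Ξ w₀)).comp θ hlog
    have h3 : HasDerivAt (fun t : ℝ => tract Ξ ((s : ℂ) + t * I))
        (deriv sramp (logMod Ξ w₀) * -(logDeriv Ξ w₀).im) θ := by
      simpa only [Function.comp_def, tract] using h2
    have : deriv sramp (logMod Ξ w₀) * -(logDeriv Ξ w₀).im = tractT Ξ w₀ := by
      rw [tractT]; ring
    rw [← this]
    exact h3

/-- `∂U_s/∂s = U_ss`. [folklore] -/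
theorem hasDerivAt_tractS_re (hΞ : Differentiable ℂ Ξ) (s θ : ℝ) :
    HasDerivAt (fun t : ℝ => tractS Ξ ((t : ℂ) + θ * I)) (tractSS Ξ ((s : ℂ) + θ * I)) s := by
  set w₀ : ℂ := (s : ℂ) + θ * I with hw₀
  by_cases hlt : ‖Ξ w₀‖ < Real.exp 1
  · have hev : ∀ᶠ t : ℝ in 𝓝 s, tractS Ξ ((t : ℂ) + θ * I) = 0 := by
      have hc : Continuous fun t : ℝ => ((t : ℂ) + θ * I) := by fun_prop
      have := (isOpen_norm_lt hΞ).preimage hc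
      exact Filter.eventually_of_mem (this.mem_nhds (by simpa [hw₀] using hlt))
        fun t ht => tractS_eq_zero_of_norm_lt ht
    rw [tractSS_eq_zero_of_norm_lt hlt]
    exact (hasDerivAt_const s (0 : ℝ)).congr_of_eventuallyEq hev
  · have h0 : Ξ w₀ ≠ 0 := by
      intro h; rw [h, norm_zero] at hlt; exact hlt (Real.exp_pos 1)
    obtain ⟨ε, hε, hball⟩ := exists_ball_log hΞ h0
    set L : ℂ → ℂ := fun w => Complex.log (Ξ w / Ξ w₀)
    have hc : Continuous fun t : ℝ => ((t : ℂ) + θ * I) := by fun_prop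
    have hev : ∀ᶠ t : ℝ in 𝓝 s, ((t : ℂ) + θ * I) ∈ Metric.ball w₀ ε := by
      have : IsOpen ((fun t : ℝ => ((t : ℂ) + θ * I)) ⁻¹' Metric.ball w₀ ε) :=
        Metric.isOpen_ball.preimage hc
      exact this.mem_nhds (by simp [hw₀, Metric.mem_ball, hε])
    -- derivative of `v` along the line
    have hlog : HasDerivAt (fun t : ℝ => logMod Ξ ((t : ℂ) + θ * I))
        ((logDeriv Ξ w₀).re) s := by
      have h1 : HasDerivAt (fun t : ℝ => (L ((t : ℂ) + θ * I)).re + Real.log ‖Ξ w₀‖)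
          ((logDeriv Ξ w₀).re) s := by
        have := (hball w₀ (Metric.mem_ball_self hε)).2.1
        exact (hasDerivAt_line_re_re this).add_const _
      refine h1.congr_of_eventuallyEq ?_
      filter_upwards [hev] with t ht using (hball _ ht).2.2
    -- derivative of `Re P` along the line
    have hP : HasDerivAt (fun t : ℝ => (logDeriv Ξ ((t : ℂ) + θ * I)).re)
        ((deriv (logDeriv Ξ) w₀).re) s :=
      hasDerivAt_line_re_re (hasDerivAt_logDeriv hΞ h0)
    -- derivative of `H'(v)` along the line
    have hH : HasDerivAt (fun t : ℝ => deriv sramp (logMod Ξ ((t : ℂ) + θ * I)))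
        (deriv (deriv sramp) (logMod Ξ w₀) * (logDeriv Ξ w₀).re) s := by
      have h := (hasDerivAt_deriv_sramp (logMod Ξ w₀)).comp s hlog
      simpa only [Function.comp_def] using h
    have h2 := hH.mul hP
    have : deriv (deriv sramp) (logMod Ξ w₀) * (logDeriv Ξ w₀).re *
          (logDeriv Ξ ((s : ℂ) + θ * I)).re +
        deriv sramp (logMod Ξ ((s : ℂ) + θ * I)) * (deriv (logDeriv Ξ) w₀).re = tractSS Ξ w₀ := by
      rw [tractSS, ← hw₀]; ring
    rw [← this]
    exact h2

/-- `∂U_θ/∂θ = U_θθ`. [folklore] -/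
theorem hasDerivAt_tractT_im (hΞ : Differentiable ℂ Ξ) (s θ : ℝ) :
    HasDerivAt (fun t : ℝ => tractT Ξ ((s : ℂ) + t * I)) (tractTT Ξ ((s : ℂ) + θ * I)) θ := by
  set w₀ : ℂ := (s : ℂ) + θ * I with hw₀
  by_cases hlt : ‖Ξ w₀‖ < Real.exp 1
  · have hev : ∀ᶠ t : ℝ in 𝓝 θ, tractT Ξ ((s : ℂ) + t * I) = 0 := by
      have hc : Continuous fun t : ℝ => ((s : ℂ) + t * I) := by fun_prop
      have := (isOpen_norm_lt hΞ).preimage hc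
      exact Filter.eventually_of_mem (this.mem_nhds (by simpa [hw₀] using hlt))
        fun t ht => tractT_eq_zero_of_norm_lt ht
    rw [tractTT_eq_zero_of_norm_lt hlt]
    exact (hasDerivAt_const θ (0 : ℝ)).congr_of_eventuallyEq hev
  · have h0 : Ξ w₀ ≠ 0 := by
      intro h; rw [h, norm_zero] at hlt; exact hlt (Real.exp_pos 1)
    obtain ⟨ε, hε, hball⟩ := exists_ball_log hΞ h0
    set L : ℂ → ℂ := fun w => Complex.log (Ξ w / Ξ w₀)
    have hc : Continuous fun t : ℝ => ((s : ℂ) + t * I) := by fun_prop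
    have hev : ∀ᶠ t : ℝ in 𝓝 θ, ((s : ℂ) + t * I) ∈ Metric.ball w₀ ε := by
      have : IsOpen ((fun t : ℝ => ((s : ℂ) + t * I)) ⁻¹' Metric.ball w₀ ε) :=
        Metric.isOpen_ball.preimage hc
      exact this.mem_nhds (by simp [hw₀, Metric.mem_ball, hε])
    have hlog : HasDerivAt (fun t : ℝ => logMod Ξ ((s : ℂ) + t * I))
        (-(logDeriv Ξ w₀).im) θ := by
      have h1 : HasDerivAt (fun t : ℝ => (L ((s : ℂ) + t * I)).re + Real.log ‖Ξ w₀‖)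
          (-(logDeriv Ξ w₀).im) θ := by
        have := (hball w₀ (Metric.mem_ball_self hε)).2.1
        exact (hasDerivAt_line_im_re this).add_const _
      refine h1.congr_of_eventuallyEq ?_
      filter_upwards [hev] with t ht using (hball _ ht).2.2
    -- derivative of `Im P` along the vertical line: `Im (P' I) = Re P'`
    have hP : HasDerivAt (fun t : ℝ => (logDeriv Ξ ((s : ℂ) + t * I)).im)
        ((deriv (logDeriv Ξ) w₀).re) θ :=
      hasDerivAt_line_im_im (hasDerivAt_logDeriv hΞ h0)
    have hH : HasDerivAt (fun t : ℝ => deriv sramp (logMod Ξ ((s : ℂ) + t * I)))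
        (deriv (deriv sramp) (logMod Ξ w₀) * -(logDeriv Ξ w₀).im) θ := by
      have h := (hasDerivAt_deriv_sramp (logMod Ξ w₀)).comp θ hlog
      simpa only [Function.comp_def] using h
    have h2 := (hH.mul hP).neg
    have : -(deriv (deriv sramp) (logMod Ξ w₀) * -(logDeriv Ξ w₀).im *
          (logDeriv Ξ ((s : ℂ) + θ * I)).im +
        deriv sramp (logMod Ξ ((s : ℂ) + θ * I)) * (deriv (logDeriv Ξ) w₀).re) = tractTT Ξ w₀ := by
      rw [tractTT, ← hw₀]; ring
    rw [← this]
    exact h2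

end Tract


/-! ### Continuity of `U` and its partial derivatives -/

section Continuity

open _root_.Complex

variable {Ξ : ℂ → ℂ}

/-- A function vanishing on `{|Ξ| < e}` and continuous at every point where `Ξ ≠ 0` is
continuous. [folklore] -/
theorem continuous_of_vanish_of_continuousAt (hΞ : Differentiable ℂ Ξ) {F : ℂ → ℝ}
    (h0 : ∀ w, ‖Ξ w‖ < Real.exp 1 → F w = 0) (h1 : ∀ w, Ξ w ≠ 0 → ContinuousAt F w) :
    Continuous F := by
  rw [continuous_iff_continuousAt]
  intro w
  by_cases hlt : ‖Ξ w‖ < Real.exp 1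
  · have hev : F =ᶠ[𝓝 w] fun _ => 0 :=
      Filter.eventually_of_mem ((isOpen_norm_lt hΞ).mem_nhds hlt) fun y hy => h0 y hy
    exact (continuousAt_congr hev).2 continuousAt_const
  · apply h1
    intro h; rw [h, norm_zero] at hlt; exact hlt (Real.exp_pos 1)

/-- Auxiliary step of the Carleman tract calculus (see the section header). [folklore] -/
theorem continuousAt_logMod {w : ℂ} (hΞ : Differentiable ℂ Ξ) (h : Ξ w ≠ 0) :
    ContinuousAt (logMod Ξ) w := by
  have h1 : ContinuousAt (fun w => ‖Ξ w‖) w := (continuous_norm.comp hΞ.continuous).continuousAt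
  exact ContinuousAt.comp (f := fun w => ‖Ξ w‖) (g := Real.log)
    (Real.continuousAt_log (norm_ne_zero_iff.2 h)) h1

/-- Auxiliary step of the Carleman tract calculus (see the section header). [folklore] -/
theorem continuousAt_logDeriv {w : ℂ} (hΞ : Differentiable ℂ Ξ) (h : Ξ w ≠ 0) :
    ContinuousAt (logDeriv Ξ) w :=
  (hasDerivAt_logDeriv hΞ h).continuousAt

/-- Auxiliary step of the Carleman tract calculus (see the section header). [folklore] -/
theorem isOpen_ne_zero (hΞ : Differentiable ℂ Ξ) : IsOpen {w : ℂ | Ξ w ≠ 0} :=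
  isOpen_ne_fun hΞ.continuous continuous_const

/-- Auxiliary step of the Carleman tract calculus (see the section header). [folklore] -/
theorem continuousAt_deriv_logDeriv {w : ℂ} (hΞ : Differentiable ℂ Ξ) (h : Ξ w ≠ 0) :
    ContinuousAt (deriv (logDeriv Ξ)) w := by
  have hd : DifferentiableOn ℂ (logDeriv Ξ) {w : ℂ | Ξ w ≠ 0} := fun y hy =>
    (hasDerivAt_logDeriv hΞ hy).differentiableAt.differentiableWithinAt
  have ha : AnalyticAt ℂ (logDeriv Ξ) w := hd.analyticAt ((isOpen_ne_zero hΞ).mem_nhds h)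
  exact ha.deriv.continuousAt

/-- Auxiliary step of the Carleman tract calculus (see the section header). [folklore] -/
theorem continuous_tract (hΞ : Differentiable ℂ Ξ) : Continuous (tract Ξ) :=
  continuous_of_vanish_of_continuousAt hΞ (fun _ hw => tract_eq_zero_of_norm_lt hw) fun _ hw =>
    continuous_sramp.continuousAt.comp (continuousAt_logMod hΞ hw)

/-- Auxiliary step of the Carleman tract calculus (see the section header). [folklore] -/
theorem continuous_tractS (hΞ : Differentiable ℂ Ξ) : Continuous (tractS Ξ) :=
  continuous_of_vanish_of_continuousAt hΞ (fun _ hw => tractS_eq_zero_of_norm_lt hw) fun _ hw =>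
    (continuous_deriv_sramp.continuousAt.comp (continuousAt_logMod hΞ hw)).mul
      (continuous_re.continuousAt.comp (continuousAt_logDeriv hΞ hw))

/-- Auxiliary step of the Carleman tract calculus (see the section header). [folklore] -/
theorem continuous_tractT (hΞ : Differentiable ℂ Ξ) : Continuous (tractT Ξ) :=
  continuous_of_vanish_of_continuousAt hΞ (fun _ hw => tractT_eq_zero_of_norm_lt hw) fun _ hw =>
    ((continuous_deriv_sramp.continuousAt.comp (continuousAt_logMod hΞ hw)).mul
      (continuous_im.continuousAt.comp (continuousAt_logDeriv hΞ hw))).neg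

/-- Auxiliary step of the Carleman tract calculus (see the section header). [folklore] -/
theorem continuous_tractSS (hΞ : Differentiable ℂ Ξ) : Continuous (tractSS Ξ) :=
  continuous_of_vanish_of_continuousAt hΞ (fun _ hw => tractSS_eq_zero_of_norm_lt hw) fun _ hw =>
    ((continuous_deriv2_sramp.continuousAt.comp (continuousAt_logMod hΞ hw)).mul
      ((continuous_re.continuousAt.comp (continuousAt_logDeriv hΞ hw)).pow 2)).add
      ((continuous_deriv_sramp.continuousAt.comp (continuousAt_logMod hΞ hw)).mul
        (continuous_re.continuousAt.comp (continuousAt_deriv_logDeriv hΞ hw)))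

/-- Auxiliary step of the Carleman tract calculus (see the section header). [folklore] -/
theorem continuous_tractTT (hΞ : Differentiable ℂ Ξ) : Continuous (tractTT Ξ) :=
  continuous_of_vanish_of_continuousAt hΞ (fun _ hw => tractTT_eq_zero_of_norm_lt hw) fun _ hw =>
    ((continuous_deriv2_sramp.continuousAt.comp (continuousAt_logMod hΞ hw)).mul
      ((continuous_im.continuousAt.comp (continuousAt_logDeriv hΞ hw)).pow 2)).sub
      ((continuous_deriv_sramp.continuousAt.comp (continuousAt_logMod hΞ hw)).mul
        (continuous_re.continuousAt.comp (continuousAt_deriv_logDeriv hΞ hw)))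

/-- Periodicity in `θ` is inherited from `Ξ`. [folklore] -/
theorem logDeriv_periodic {c : ℂ} (hper : ∀ w, Ξ (w + c) = Ξ w) (w : ℂ) :
    logDeriv Ξ (w + c) = logDeriv Ξ w := by
  have hfun : (fun w => Ξ (w + c)) = Ξ := funext hper
  have h1 : deriv Ξ (w + c) = deriv Ξ w := by
    rw [← deriv_comp_add_const, hfun]
  rw [logDeriv_apply, logDeriv_apply, h1, hper]

/-- Auxiliary step of the Carleman tract calculus (see the section header). [folklore] -/
theorem deriv_logDeriv_periodic {c : ℂ} (hper : ∀ w, Ξ (w + c) = Ξ w) (w : ℂ) :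
    deriv (logDeriv Ξ) (w + c) = deriv (logDeriv Ξ) w := by
  have hfun : (fun w => logDeriv Ξ (w + c)) = logDeriv Ξ := funext (logDeriv_periodic hper)
  rw [← deriv_comp_add_const, hfun]

/-- Auxiliary step of the Carleman tract calculus (see the section header). [folklore] -/
theorem tract_periodic {c : ℂ} (hper : ∀ w, Ξ (w + c) = Ξ w) (w : ℂ) :
    tract Ξ (w + c) = tract Ξ w := by
  simp [tract, logMod, hper]

/-- Auxiliary step of the Carleman tract calculus (see the section header). [folklore] -/
theorem tractT_periodic {c : ℂ} (hper : ∀ w, Ξ (w + c) = Ξ w) (w : ℂ) :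
    tractT Ξ (w + c) = tractT Ξ w := by
  simp [tractT, logMod, hper, logDeriv_periodic hper]

end Continuity

/-! ### Differentiating interval integrals of jointly continuous integrands -/

section ParamIntegral

/-- Differentiation under the integral sign for a jointly continuous integrand with a jointly
continuous partial derivative. [folklore] -/
theorem hasDerivAt_intervalIntegral_of_continuous {F F' : ℝ → ℝ → ℝ} {a b : ℝ}
    (hF : Continuous fun p : ℝ × ℝ => F p.1 p.2) (hF' : Continuous fun p : ℝ × ℝ => F' p.1 p.2)
    (hd : ∀ x t, HasDerivAt (fun x => F x t) (F' x t) x) (x₀ : ℝ) :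
    HasDerivAt (fun x => ∫ t in a..b, F x t) (∫ t in a..b, F' x₀ t) x₀ := by
  -- a uniform bound for `F'` on `closedBall x₀ 1 × [a, b]`
  have hK : IsCompact (Metric.closedBall x₀ 1 ×ˢ Set.uIcc a b) :=
    (isCompact_closedBall x₀ 1).prod isCompact_uIcc
  obtain ⟨C, hC⟩ := hK.exists_bound_of_continuousOn hF'.continuousOn
  have hFx : ∀ x, Continuous (F x) := fun x => hF.comp (Continuous.prodMk_right x)
  have hF'x : ∀ x, Continuous (F' x) := fun x => hF'.comp (Continuous.prodMk_right x)
  refine (intervalIntegral.hasDerivAt_integral_of_dominated_loc_of_deriv_le (bound := fun _ => C)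
    (Metric.closedBall_mem_nhds x₀ zero_lt_one) ?_ ?_ ?_ ?_ ?_ ?_).2
  · exact Filter.Eventually.of_forall fun x => (hFx x).aestronglyMeasurable
  · exact (hFx x₀).intervalIntegrable _ _
  · exact (hF'x x₀).aestronglyMeasurable
  · refine Filter.Eventually.of_forall fun t ht x hx => ?_
    exact hC (x, t) ⟨hx, Set.uIoc_subset_uIcc ht⟩
  · exact intervalIntegrable_const
  · exact Filter.Eventually.of_forall fun t _ x _ => hd x t

end ParamIntegral

/-! ### Carleman's functionals `V(s) = ∫ U²` and `M(s) = ∫ U` over the circle `|z| = e^s` -/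

section Carleman

open _root_.Complex _root_.MeasureTheory intervalIntegral

variable (Ξ : ℂ → ℂ)

/-- `V(s) = ∫₀^{2π} U(s + iθ)² dθ`. [cite: Romanov2014, App. III proof of Lemma 27 (the function `v`)] -/
def sqInt (s : ℝ) : ℝ := ∫ θ in (0 : ℝ)..2 * π, tract Ξ ((s : ℂ) + θ * I) ^ 2

/-- `M(s) = ∫₀^{2π} U(s + iθ) dθ` (`2π ×` the circular mean of `U`). [folklore] -/
def meanInt (s : ℝ) : ℝ := ∫ θ in (0 : ℝ)..2 * π, tract Ξ ((s : ℂ) + θ * I)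

/-- `V'(s) = ∫ 2 U U_s`. [folklore] -/
def sqInt' (s : ℝ) : ℝ :=
  ∫ θ in (0 : ℝ)..2 * π, 2 * tract Ξ ((s : ℂ) + θ * I) * tractS Ξ ((s : ℂ) + θ * I)

/-- `V''(s) = ∫ 2 (U_s² + U U_ss)`. [folklore] -/
def sqInt'' (s : ℝ) : ℝ :=
  ∫ θ in (0 : ℝ)..2 * π, 2 * (tractS Ξ ((s : ℂ) + θ * I) ^ 2 +
    tract Ξ ((s : ℂ) + θ * I) * tractSS Ξ ((s : ℂ) + θ * I))

/-- `∫ U_s²`. [folklore] -/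
def sqIntS (s : ℝ) : ℝ := ∫ θ in (0 : ℝ)..2 * π, tractS Ξ ((s : ℂ) + θ * I) ^ 2

/-- `∫ U_θ²`. [folklore] -/
def sqIntT (s : ℝ) : ℝ := ∫ θ in (0 : ℝ)..2 * π, tractT Ξ ((s : ℂ) + θ * I) ^ 2

/-- `M'(s) = ∫ U_s`. [folklore] -/
def meanInt' (s : ℝ) : ℝ := ∫ θ in (0 : ℝ)..2 * π, tractS Ξ ((s : ℂ) + θ * I)

/-- `M''(s) = ∫ U_ss`. [folklore] -/
def meanInt'' (s : ℝ) : ℝ := ∫ θ in (0 : ℝ)..2 * π, tractSS Ξ ((s : ℂ) + θ * I)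

variable {Ξ}

/-- Auxiliary step of the Carleman tract calculus (see the section header). [folklore] -/
private theorem cont₂ {G : ℂ → ℝ} (hG : Continuous G) :
    Continuous fun p : ℝ × ℝ => G ((p.1 : ℂ) + p.2 * I) := by
  fun_prop

variable (hΞ : Differentiable ℂ Ξ)
include hΞ

/-- Auxiliary step of the Carleman tract calculus (see the section header). [folklore] -/
theorem hasDerivAt_sqInt (s : ℝ) : HasDerivAt (sqInt Ξ) (sqInt' Ξ s) s := by
  unfold sqInt sqInt'
  refine hasDerivAt_intervalIntegral_of_continuous (F := fun x t => tract Ξ ((x : ℂ) + t * I) ^ 2)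
    (F' := fun x t => 2 * tract Ξ ((x : ℂ) + t * I) * tractS Ξ ((x : ℂ) + t * I)) ?_ ?_ ?_ s
  · exact (cont₂ (continuous_tract hΞ)).pow 2
  · exact (continuous_const.mul (cont₂ (continuous_tract hΞ))).mul (cont₂ (continuous_tractS hΞ))
  · intro x t
    have h := (hasDerivAt_tract_re hΞ x t).pow 2
    refine h.congr_deriv ?_
    simp

/-- Auxiliary step of the Carleman tract calculus (see the section header). [folklore] -/
theorem hasDerivAt_sqInt' (s : ℝ) : HasDerivAt (sqInt' Ξ) (sqInt'' Ξ s) s := by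
  unfold sqInt' sqInt''
  refine hasDerivAt_intervalIntegral_of_continuous
    (F := fun x t => 2 * tract Ξ ((x : ℂ) + t * I) * tractS Ξ ((x : ℂ) + t * I))
    (F' := fun x t => 2 * (tractS Ξ ((x : ℂ) + t * I) ^ 2 +
      tract Ξ ((x : ℂ) + t * I) * tractSS Ξ ((x : ℂ) + t * I))) ?_ ?_ ?_ s
  · exact (continuous_const.mul (cont₂ (continuous_tract hΞ))).mul (cont₂ (continuous_tractS hΞ))
  · exact continuous_const.mul (((cont₂ (continuous_tractS hΞ)).pow 2).add
      ((cont₂ (continuous_tract hΞ)).mul (cont₂ (continuous_tractSS hΞ))))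
  · intro x t
    have h := ((hasDerivAt_tract_re hΞ x t).const_mul 2).mul (hasDerivAt_tractS_re hΞ x t)
    refine h.congr_deriv ?_
    ring

/-- Auxiliary step of the Carleman tract calculus (see the section header). [folklore] -/
theorem hasDerivAt_meanInt (s : ℝ) : HasDerivAt (meanInt Ξ) (meanInt' Ξ s) s := by
  unfold meanInt meanInt'
  exact hasDerivAt_intervalIntegral_of_continuous (F := fun x t => tract Ξ ((x : ℂ) + t * I))
    (F' := fun x t => tractS Ξ ((x : ℂ) + t * I)) (cont₂ (continuous_tract hΞ))
    (cont₂ (continuous_tractS hΞ)) (fun x t => hasDerivAt_tract_re hΞ x t) s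

/-- Auxiliary step of the Carleman tract calculus (see the section header). [folklore] -/
theorem hasDerivAt_meanInt' (s : ℝ) : HasDerivAt (meanInt' Ξ) (meanInt'' Ξ s) s := by
  unfold meanInt' meanInt''
  exact hasDerivAt_intervalIntegral_of_continuous (F := fun x t => tractS Ξ ((x : ℂ) + t * I))
    (F' := fun x t => tractSS Ξ ((x : ℂ) + t * I)) (cont₂ (continuous_tractS hΞ))
    (cont₂ (continuous_tractSS hΞ)) (fun x t => hasDerivAt_tractS_re hΞ x t) s

omit hΞ in
/-- Integration by parts in `θ` over a period: `∫ U U_θθ = -∫ U_θ²`. [folklore] -/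
theorem integral_tract_mul_tractTT (hΞ : Differentiable ℂ Ξ)
    (hper : ∀ w, Ξ (w + 2 * π * I) = Ξ w) (s : ℝ) :
    ∫ θ in (0 : ℝ)..2 * π, tract Ξ ((s : ℂ) + θ * I) * tractTT Ξ ((s : ℂ) + θ * I) =
      -sqIntT Ξ s := by
  have h := intervalIntegral.integral_mul_deriv_eq_deriv_mul (a := 0) (b := 2 * π)
    (u := fun θ : ℝ => tract Ξ ((s : ℂ) + θ * I)) (v := fun θ : ℝ => tractT Ξ ((s : ℂ) + θ * I))
    (u' := fun θ : ℝ => tractT Ξ ((s : ℂ) + θ * I)) (v' := fun θ : ℝ => tractTT Ξ ((s : ℂ) + θ * I))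
    (fun θ _ => hasDerivAt_tract_im hΞ s θ) (fun θ _ => hasDerivAt_tractT_im hΞ s θ)
    ((cont₂ (continuous_tractT hΞ)).comp (Continuous.prodMk_right s)
      |>.intervalIntegrable _ _)
    ((cont₂ (continuous_tractTT hΞ)).comp (Continuous.prodMk_right s)
      |>.intervalIntegrable _ _)
  have hw : ((s : ℂ) + (2 * π : ℝ) * I) = ((s : ℂ) + (0 : ℝ) * I) + 2 * π * I := by
    push_cast; ring
  have hb1 : tract Ξ ((s : ℂ) + (2 * π : ℝ) * I) = tract Ξ ((s : ℂ) + (0 : ℝ) * I) := by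
    rw [hw, tract_periodic hper]
  have hb2 : tractT Ξ ((s : ℂ) + (2 * π : ℝ) * I) = tractT Ξ ((s : ℂ) + (0 : ℝ) * I) := by
    rw [hw, tractT_periodic hper]
  simp only [hb1, hb2, sub_self, zero_sub] at h
  rw [h, sqIntT]
  congr 1
  refine intervalIntegral.integral_congr fun θ _ => ?_
  ring

omit hΞ in
/-- `∫ U_θθ = 0` over a period. [folklore] -/
theorem integral_tractTT (hΞ : Differentiable ℂ Ξ) (hper : ∀ w, Ξ (w + 2 * π * I) = Ξ w) (s : ℝ) :
    ∫ θ in (0 : ℝ)..2 * π, tractTT Ξ ((s : ℂ) + θ * I) = 0 := by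
  rw [intervalIntegral.integral_eq_sub_of_hasDerivAt (fun θ _ => hasDerivAt_tractT_im hΞ s θ)
    ((cont₂ (continuous_tractTT hΞ)).comp (Continuous.prodMk_right s) |>.intervalIntegrable _ _)]
  have hw : ((s : ℂ) + (2 * π : ℝ) * I) = ((s : ℂ) + (0 : ℝ) * I) + 2 * π * I := by
    push_cast; ring
  rw [hw, tractT_periodic hper, sub_self]

/-- **Carleman's convexity inequality** (Romanov, proof of Lemma 27, (diffineq) in the coordinates
`s = log r`): `V'' ≥ 2 ∫ U_s² + 2 ∫ U_θ²`. [cite: Romanov2014, App. III Lemma 27] -/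
theorem sqInt''_ge (hper : ∀ w, Ξ (w + 2 * π * I) = Ξ w) (s : ℝ) :
    2 * sqIntS Ξ s + 2 * sqIntT Ξ s ≤ sqInt'' Ξ s := by
  have hiS : IntervalIntegrable (fun θ : ℝ => tractS Ξ ((s : ℂ) + θ * I) ^ 2) volume 0 (2 * π) :=
    ((cont₂ (continuous_tractS hΞ)).comp (Continuous.prodMk_right s)).pow 2
      |>.intervalIntegrable _ _
  have hiP : IntervalIntegrable
      (fun θ : ℝ => tract Ξ ((s : ℂ) + θ * I) * tractSS Ξ ((s : ℂ) + θ * I)) volume 0 (2 * π) :=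
    (((cont₂ (continuous_tract hΞ)).comp (Continuous.prodMk_right s)).mul
      ((cont₂ (continuous_tractSS hΞ)).comp (Continuous.prodMk_right s))).intervalIntegrable _ _
  have hiQ : IntervalIntegrable
      (fun θ : ℝ => tract Ξ ((s : ℂ) + θ * I) * tractTT Ξ ((s : ℂ) + θ * I)) volume 0 (2 * π) :=
    (((cont₂ (continuous_tract hΞ)).comp (Continuous.prodMk_right s)).mul
      ((cont₂ (continuous_tractTT hΞ)).comp (Continuous.prodMk_right s))).intervalIntegrable _ _
  -- `V'' = 2 ∫ U_s² + 2 ∫ U U_ss`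
  have h1 : sqInt'' Ξ s = 2 * sqIntS Ξ s +
      2 * ∫ θ in (0 : ℝ)..2 * π, tract Ξ ((s : ℂ) + θ * I) * tractSS Ξ ((s : ℂ) + θ * I) := by
    rw [sqInt'', sqIntS, ← intervalIntegral.integral_const_mul, ← intervalIntegral.integral_const_mul,
      ← intervalIntegral.integral_add (hiS.const_mul 2) (hiP.const_mul 2)]
    refine intervalIntegral.integral_congr fun θ _ => ?_
    ring
  -- `∫ U U_ss = ∫ U (U_ss + U_θθ) - ∫ U U_θθ ≥ ∫ U_θ²`
  have h2 : sqIntT Ξ s ≤ ∫ θ in (0 : ℝ)..2 * π, tract Ξ ((s : ℂ) + θ * I) * tractSS Ξ ((s : ℂ) + θ * I) := by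
    have hsplit : (∫ θ in (0 : ℝ)..2 * π, tract Ξ ((s : ℂ) + θ * I) * tractSS Ξ ((s : ℂ) + θ * I)) =
        (∫ θ in (0 : ℝ)..2 * π, tract Ξ ((s : ℂ) + θ * I) *
          (tractSS Ξ ((s : ℂ) + θ * I) + tractTT Ξ ((s : ℂ) + θ * I))) -
        ∫ θ in (0 : ℝ)..2 * π, tract Ξ ((s : ℂ) + θ * I) * tractTT Ξ ((s : ℂ) + θ * I) := by
      rw [← intervalIntegral.integral_sub (hiP.add hiQ |>.congr ?_) hiQ]
      · refine intervalIntegral.integral_congr fun θ _ => ?_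
        ring
      · intro θ _
        ring
    rw [hsplit, integral_tract_mul_tractTT hΞ hper, sub_neg_eq_add]
    have hnn : 0 ≤ ∫ θ in (0 : ℝ)..2 * π, tract Ξ ((s : ℂ) + θ * I) *
        (tractSS Ξ ((s : ℂ) + θ * I) + tractTT Ξ ((s : ℂ) + θ * I)) := by
      refine intervalIntegral.integral_nonneg (by positivity) fun θ _ => ?_
      exact mul_nonneg (tract_nonneg Ξ _) (tractSS_add_tractTT_nonneg Ξ _)
    linarith
  rw [h1]
  linarith

/-- `M'' = ∫ (U_ss + U_θθ) = ∫ H''(log|Ξ|) |Ξ'/Ξ|² ≥ 0`: the circular means of `U` are convex in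
`s = log r`. [folklore] -/
theorem meanInt''_eq (hper : ∀ w, Ξ (w + 2 * π * I) = Ξ w) (s : ℝ) :
    meanInt'' Ξ s = ∫ θ in (0 : ℝ)..2 * π,
      deriv (deriv sramp) (logMod Ξ ((s : ℂ) + θ * I)) * ‖logDeriv Ξ ((s : ℂ) + θ * I)‖ ^ 2 := by
  have hiS : IntervalIntegrable (fun θ : ℝ => tractSS Ξ ((s : ℂ) + θ * I)) volume 0 (2 * π) :=
    ((cont₂ (continuous_tractSS hΞ)).comp (Continuous.prodMk_right s)).intervalIntegrable _ _
  have hiT : IntervalIntegrable (fun θ : ℝ => tractTT Ξ ((s : ℂ) + θ * I)) volume 0 (2 * π) :=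
    ((cont₂ (continuous_tractTT hΞ)).comp (Continuous.prodMk_right s)).intervalIntegrable _ _
  have h : meanInt'' Ξ s = (∫ θ in (0 : ℝ)..2 * π,
      (tractSS Ξ ((s : ℂ) + θ * I) + tractTT Ξ ((s : ℂ) + θ * I))) -
      ∫ θ in (0 : ℝ)..2 * π, tractTT Ξ ((s : ℂ) + θ * I) := by
    rw [intervalIntegral.integral_add hiS hiT, meanInt'']; ring
  rw [h, integral_tractTT hΞ hper, sub_zero]
  exact intervalIntegral.integral_congr fun θ _ => tractSS_add_tractTT Ξ _

/-- Auxiliary step of the Carleman tract calculus (see the section header). [folklore] -/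
theorem meanInt''_nonneg (hper : ∀ w, Ξ (w + 2 * π * I) = Ξ w) (s : ℝ) : 0 ≤ meanInt'' Ξ s := by
  rw [meanInt''_eq hΞ hper]
  refine intervalIntegral.integral_nonneg (by positivity) fun θ _ => ?_
  exact mul_nonneg (deriv2_ramp_nonneg _) (by positivity)

/-- Cauchy–Schwarz: `V'² ≤ 4 V ∫ U_s²`. [folklore] -/
theorem sqInt'_sq_le (s : ℝ) : sqInt' Ξ s ^ 2 ≤ 4 * sqInt Ξ s * sqIntS Ξ s := by
  have hiU : IntervalIntegrable (fun θ : ℝ => tract Ξ ((s : ℂ) + θ * I) ^ 2) volume 0 (2 * π) :=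
    (((cont₂ (continuous_tract hΞ)).comp (Continuous.prodMk_right s)).pow 2).intervalIntegrable _ _
  have hiS : IntervalIntegrable (fun θ : ℝ => tractS Ξ ((s : ℂ) + θ * I) ^ 2) volume 0 (2 * π) :=
    (((cont₂ (continuous_tractS hΞ)).comp (Continuous.prodMk_right s)).pow 2).intervalIntegrable _ _
  have hiM : IntervalIntegrable
      (fun θ : ℝ => 2 * tract Ξ ((s : ℂ) + θ * I) * tractS Ξ ((s : ℂ) + θ * I)) volume 0 (2 * π) :=
    ((continuous_const.mul ((cont₂ (continuous_tract hΞ)).comp (Continuous.prodMk_right s))).mul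
      ((cont₂ (continuous_tractS hΞ)).comp (Continuous.prodMk_right s))).intervalIntegrable _ _
  -- the quadratic `t ↦ ∫ (U_s t + U)² = (∫U_s²) t² + (∫ 2 U U_s) t + ∫ U² ≥ 0`
  have hq : ∀ t : ℝ, 0 ≤ sqIntS Ξ s * (t * t) + sqInt' Ξ s * t + sqInt Ξ s := by
    intro t
    have : sqIntS Ξ s * (t * t) + sqInt' Ξ s * t + sqInt Ξ s =
        ∫ θ in (0 : ℝ)..2 * π, (tractS Ξ ((s : ℂ) + θ * I) * t + tract Ξ ((s : ℂ) + θ * I)) ^ 2 := by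
      rw [sqIntS, sqInt', sqInt, ← intervalIntegral.integral_mul_const,
        ← intervalIntegral.integral_mul_const,
        ← intervalIntegral.integral_add (hiS.mul_const _) (hiM.mul_const _),
        ← intervalIntegral.integral_add ((hiS.mul_const _).add (hiM.mul_const _)) hiU]
      refine intervalIntegral.integral_congr fun θ _ => ?_
      ring
    rw [this]
    exact intervalIntegral.integral_nonneg (by positivity) fun θ _ => sq_nonneg _
  have hd := discrim_le_zero hq
  rw [discrim] at hd
  linarith

end Carleman

end CarlemanTract

end Literature.Analysis.Complex
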